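import Summits.HubbardSuperconductivity.HubbardSuperconductivity.Theses.YangSpectral

/-!
# Route `YangSpectral` — assembly item `Assembly` (stmt-HubbardSuperconductivity-0174)

`YangSpectral.Assembly` (Theses/YangSpectral.lean) is the curried implication
`YangB1gRayleigh → YangDominantModeOverlap → YangSpectralGlue → YangSpectralBridge → HubbardSuperconductivity`
where, by definition in the route file, `YangSpectralGlue := YangB1gRayleigh → YangDominantModeOverlap →
YangSpectralThesis` (cruxes ⇒ repaired thesis) and `YangSpectralBridge := YangSpectralThesis →
HubbardSuperconductivity` (thesis ⇒ summit). The assembly is therefore pure logic — modus ponens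
twice: the glue applied to the two cruxes gives the thesis, the bridge applied to the thesis gives
the summit. (This route file carries no planner `closes` theorem; the composition below is the
whole content of the item.) No analysis, no new definitions, no restatement of any item.

Source for the order parameter being assembled: C. N. Yang, Rev. Mod. Phys. 34 (1962) 694 (ODLRO);
D. J. Scalapino, Phys. Rep. 250 (1995) 329, §2.
-/

-- the mandated namespace `Summit.<Summit>.<Problem>.Theorems` repeats `HubbardSuperconductivity`
-- (single-problem summit, D-0017), which the `dupNamespace` linter flags on every declaration
set_option linter.dupNamespace false

namespace Summit.HubbardSuperconductivity.HubbardSuperconductivity.Theorems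

/-- **Assembly of route `YangSpectral`** (item `stmt-HubbardSuperconductivity-0174`):
`YangB1gRayleigh → YangDominantModeOverlap → YangSpectralGlue → YangSpectralBridge →
HubbardSuperconductivity`. Since `YangSpectralGlue` unfolds to
`YangB1gRayleigh → YangDominantModeOverlap → YangSpectralThesis` and `YangSpectralBridge` to
`YangSpectralThesis → HubbardSuperconductivity`, the proof is `bridge (glue rayleigh overlap)`.
[folklore] -/
theorem yangSpectral_assembly_proof :
    Summit.HubbardSuperconductivity.HubbardSuperconductivity.Theses.YangSpectral.Assembly :=
  fun hRayleigh hOverlap hGlue hBridge => hBridge (hGlue hRayleigh hOverlap)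

end Summit.HubbardSuperconductivity.HubbardSuperconductivity.Theorems
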